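import Literature.Computability.AlgebraicComplexity.RazUniversalCircuits
import HarnessLib

/-!
# Raz's universal circuit-graph: the image of `Γ` is stable under linear substitutions

R. Raz, *Elusive functions and lower bounds for arithmetic circuits*, Theory of Computing 6 (2010),
§2.4 / §3.2.  The universal circuit-graph (`RazUniversal.out`, `RazUniversal.outVal`) has its input
variables only at level `1`, where they enter through `Y`-weighted sums `∑_t y_t z_t`, i.e. through
ARBITRARY linear forms.  Consequently a linear substitution `z_t ↦ ∑_{t'} A t t' z_{t'}` of the
variables in an output `OUT(y)` is absorbed into the labels: `OUT(y)(A z) = OUT(y')` for an explicit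
relabelling `y'` (`RazUniversal.outVal_substLabels`, `RazUniversal.exists_labels_outVal_linearSubst`).
Hence the image of Raz's polynomial map `Γ` — and its Zariski closure — is stable under the action
of ALL linear endomorphisms of the variable space (not only `GL`), the structural input of any
representation-theoretic (highest-weight-vector) description of its vanishing ideal. [folklore]

## References
* R. Raz, Theory of Computing 6 (2010) 135–177, Prop. 2.8 (pp. 154–155), §3.2 (p. 157).
-/

noncomputable section

open MvPolynomial

namespace Literature.Computability.AlgebraicComplexity

namespace RazUniversal

universe u v

variable {R : Type u} [CommSemiring R] {σ : Type v} [Fintype σ] {r N : ℕ}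

/-- The linear substitution `z_t ↦ ∑_{t'} A t t' • z_{t'}` as an `R`-algebra endomorphism of `R[Z]`.
[folklore] -/
def linSubst (A : σ → σ → R) : MvPolynomial σ R →ₐ[R] MvPolynomial σ R :=
  aeval fun t => ∑ t', A t t' • X t'

/-- The relabelling absorbing the substitution `A`: every edge leaving a LEAF `t'` (into a slot sum
or into the output gate) gets the label `∑_t A t t' · y(edge from t)`; all other labels are kept.
[folklore] -/
def substLabels (A : σ → σ → R) (y : Lab σ r N → R) : Lab σ r N → R
  | Sum.inl (d, j, k, side, Sum.inl t') => ∑ t, A t t' * y (Sum.inl (d, j, k, side, Sum.inl t))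
  | Sum.inl (d, j, k, side, Sum.inr b) => y (Sum.inl (d, j, k, side, Sum.inr b))
  | Sum.inr (Sum.inl t') => ∑ t, A t t' * y (Sum.inr (Sum.inl t))
  | Sum.inr (Sum.inr b) => y (Sum.inr (Sum.inr b))

/-- A weighted sum over all nodes of one level, with leaf weights transformed by `A` and slot values
substituted, is the substitution of the original weighted sum. [folklore] -/
theorem sum_substLabels_smul (A : σ → σ → R) (y : Lab σ r N → R) (d : Fin (r + 1))
    (w w' : BIdx σ r N → R)
    (hleaf : ∀ t', w' (Sum.inl t') = ∑ t, A t t' * w (Sum.inl t))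
    (hslot : ∀ b, w' (Sum.inr b) = w (Sum.inr b))
    (hval : ∀ b : Fin r × Fin N, baseVal (substLabels A y) d (Sum.inr b) =
      linSubst A (baseVal y d (Sum.inr b))) :
    ∑ b, w' b • baseVal (substLabels A y) d b = linSubst A (∑ b, w b • baseVal y d b) := by
  rw [map_sum, Fintype.sum_sum_type, Fintype.sum_sum_type]
  congr 1
  · -- leaves: `∑_{t'} (∑_t A t t' w_t) • [d = 1] z_{t'} = linSubst (∑_t w_t • [d = 1] z_t)`
    simp only [baseVal_inl, hleaf]
    split_ifs with h1
    · simp only [map_smul, linSubst, aeval_X, Finset.smul_sum, Finset.sum_smul, smul_smul]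
      rw [Finset.sum_comm]
      simp only [mul_comm]
    · simp
  · refine Finset.sum_congr rfl fun b _ => ?_
    rw [hslot, hval, map_smul]

/-- **Slot values are substituted**: for every level `d` and every product slot `b`,
`g_{d,b}(y') = g_{d,b}(y)(A z)`. [folklore] -/
theorem baseVal_substLabels (A : σ → σ → R) (y : Lab σ r N → R) :
    ∀ (n : ℕ) (d : Fin (r + 1)), (d : ℕ) = n → ∀ b : Fin r × Fin N,
      baseVal (substLabels A y) d (Sum.inr b) = linSubst A (baseVal y d (Sum.inr b)) := by
  intro n
  induction n using Nat.strong_induction_on with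
  | _ n ih =>
    rintro d rfl ⟨j, k⟩
    by_cases h : 1 ≤ (j : ℕ) ∧ (j : ℕ) < (d : ℕ)
    · rw [baseVal_inr _ _ _ _ h, baseVal_inr _ _ _ _ h, map_mul]
      congr 1
      · exact sum_substLabels_smul A y _ _ _ (fun t' => rfl) (fun b => rfl)
          (fun b => ih (j : ℕ) h.2 (Fin.castSucc j) rfl b)
      · exact sum_substLabels_smul A y _ _ _ (fun t' => rfl) (fun b => rfl)
          (fun b => ih ((d : ℕ) - j) (by omega) ⟨(d : ℕ) - j, _⟩ rfl b)
    · rw [baseVal_inr_of_not _ _ _ _ h, baseVal_inr_of_not _ _ _ _ h, map_zero]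

/-- **Raz's universal circuit absorbs linear substitutions**: `OUT(y)(A z) = OUT(y')` with
`y' = substLabels A y`.  Hence the image of `Γ` (and its closure) is stable under every linear
endomorphism `z ↦ A z` of the variables. [folklore] -/
theorem outVal_substLabels (A : σ → σ → R) (y : Lab σ r N → R) :
    outVal (substLabels A y) = linSubst A (outVal y) := by
  rw [outVal_eq, outVal_eq]
  exact sum_substLabels_smul A y (Fin.last r) (fun b => y (Sum.inr b))
    (fun b => substLabels A y (Sum.inr b)) (fun t' => rfl) (fun b => rfl)
    (fun b => baseVal_substLabels A y r (Fin.last r) rfl b)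

/-- Existential form: every linear substitute of an output is an output. [folklore] -/
theorem exists_labels_outVal_linearSubst (A : σ → σ → R) (y : Lab σ r N → R) :
    ∃ y' : Lab σ r N → R, outVal y' = aeval (fun t => ∑ t', A t t' • X t') (outVal y) :=
  ⟨substLabels A y, outVal_substLabels A y⟩

end RazUniversal

end Literature.Computability.AlgebraicComplexity

end
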